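import Mathlib
import Literature.MathematicalPhysics.QuantumFieldTheory.MagnenRivasseauSeneor1993.MRS93StabilityEstimate
import HarnessLib

/-!
# Magnen–Rivasseau–Sénéor, *Construction of YM₄ with an infrared cutoff* (CMP 155, 1993), §VI LEMMA VI.2 — the printed warrant
# «it is easy to check» (p.374 tl.4–8) made explicit: Lemma VI.2 (VI.20a/b) FOLLOWS, by elementary real analysis (kernel-checked),
# from the three analytic inputs the sentence names — a quantitative first order (VI.18)–(VI.19), boundedness on compact middle
# ranges, and linear growth of the logarithms at large β

statement-level skeleton of published theorems with citation tags; proofs where landed; nothing here is a claim about the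
Yang–Mills mass gap, about continuum YM₄ on T⁴, or about the Clay problem

**Citation header (reproduction of PUBLISHED work).** J. Magnen, V. Rivasseau, R. Sénéor, *Construction of YM₄ with an infrared
cutoff*, Commun. Math. Phys. **155** (1993) 325–383 [MagnenRivasseauSeneor1993], Sect. VI p.374 [PDF 50] tl.1–16 (page images
`run/shared/lean/pub/lit-balaban/inprint/lit-balaban-p14/renders-cmp155/p50_full_s6.png`, `p50_top_s2.png`, `p50_lemmaVI2_s2.png`; held scan
`paper:magnen1993-cmp155-mrs-ym4-infrared-cutoff`, PDF sha256 fa4ddac3…). Cell pub-balaban-gaps (YM blitz, track G3), seat mrs-lit-2; record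
`run/shared/lean/pub/pub-balaban-gaps/g3/MRS-AS-PRINTED-estimates.md`. Imports `MRS93StabilityEstimate.lean` for the typed statement
`Stability.LemmaVI2Printed` (Lemma VI.2 AS PRINTED, a predicate on the angle-averaged integrand `F β κ t ζ`).

**Grade of record (lit-balaban YM-INPRINT.md row D1).** Lemma VI.2: **SKETCH** — fit-ref B: «one-sentence warrant, ‹it is easy to check›,
p.374 tl.4–8; constants K₁, K₂ not derived». This file does NOT prove Lemma VI.2 (the polynomial `P` of the 12 × 12 determinant (VI.9) is
not computed in print for ζ ≠ 1, so its integrand `F` is not available); it proves that the lemma's CONCLUSION follows from three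
explicit, named properties of `F` — exactly the ones the warrant sentence invokes — with explicit `K₁, K₂`. It upgrades nothing; it says
precisely what a proof of Lemma VI.2 must supply.

**What the paper prints (verbatim, p.374 [PDF 50]).** tl.1–3 (VI.19): «If we restrict us to the region 0 ≤ ζ ≤ 1, we have
(β/2)(1 + t²)[−3ζ/2 − 1/2 − κ(2 − (3/2)ζ)] ≤ −(β/4)(1 + κ) ≤ −(β/4).» tl.4–8: «Now using the fact that κ, t, cosθ, sinφ, ζ and ζ⁻¹ all vary
in compact intervals (for ζ and ζ⁻¹ this is because we can restrict us to a small interval centered respectively around 3/13 or 13/3), and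
the fact that the logarithms of explicit polynomials in β such as those of (VI.14) are bounded by a constant times β at large β (uniform in
κ, t, cosθ, sinφ, ζ and ζ⁻¹ by compactness) it is easy to check the following lemma:» **Lemma VI.2** tl.9–16: «If 0 ≤ ζ ≤ 1 there exists two
(large…) constants K₁ and K₂ such that [F(β, κ, t, ζ)] ≤ K₂β if β ≥ (K₁)⁻¹ (VI.20a); ≤ −(β/8) if β ≤ (K₁)⁻¹. (VI.20b)» — with (VI.18)
p.373: «[F] ≅_{β→0} (β/2)(1 + t²)[−3ζ/2 − 1/2 − κ(2 − (3/2)ζ)] + O(β²)».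

**What is proved here (zero `sorry`, zero named facts).** For a fixed `ζ` and an abstract integrand `F : ℝ → ℝ → ℝ → ℝ → ℝ`:
* (H1) `SmallBetaExpansion F ζ β₀ C` — «(VI.18) + (VI.19) with a uniform `O(β²)`»: for `0 ≤ β ≤ β₀`, `κ, t ∈ [0,1]`:
  `F β κ t ζ ≤ −β/4 + Cβ²`;
* (H2) `MiddleRangeBound F ζ a b B` — «κ, t … vary in compact intervals»: `F ≤ B` for `β ∈ [a, b]`, `κ, t ∈ [0,1]`;
* (H3) `LargeBetaLinear F ζ β₁ C′` — «the logarithms … are bounded by a constant times β at large β»: `F ≤ C′β` for `β ≥ β₁`;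
* `lemmaVI2_at_of_inputs` — (H1) with `β₀ > 0`, `C ≥ 0`, (H2) on `[K₁⁻¹, β₁]` for the explicit `K₁⁻¹ := min β₀ (1/(8C + 1))`, (H3) ⟹ the
  body of Lemma VI.2 at this `ζ` with the explicit `K₂ := max C′ 0 + max B 0 · K₁ + 1`; `lemmaVI2Printed_of_inputs` — the same for every
  `ζ ∈ [0,1]` gives `Stability.LemmaVI2Printed F`.
The arithmetic of the small-β branch is the printed one: `−β/4 + Cβ² ≤ −β/8` as soon as `β ≤ 1/(8C)`.

**Readings (declared).** (i) (H1)–(H3) are hypotheses ON `F`, named and explicit; none is asserted. (ii) The middle range (H2) is what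
«compact intervals» buys between the small-β and large-β regimes; the paper does not spell it out. (iii) ζ is fixed throughout (the
construction uses one ζ near 3/13), as in `LemmaVI2Printed`.

**What is NOT claimed.** (H1)–(H3) themselves (they require the polynomial `P`, uncomputed in print for ζ ≠ 1, and for ζ = 1 the contour
integrals of Appendix 1); Lemma VI.2; anything of Bałaban's.
-/

noncomputable section

namespace Literature.MathematicalPhysics.QuantumFieldTheory.MagnenRivasseauSeneor1993

namespace Stability

/-- (H1) «(VI.18)–(VI.19) with a uniform remainder»: for `0 ≤ β ≤ β₀` and `κ, t ∈ [0,1]`, `F β κ t ζ ≤ −β/4 + Cβ²` (the first order is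
`≤ −β/4` by (VI.19); `C` bounds the `O(β²)` of (VI.18) uniformly — «the polynomial P has a fixed number of (in principle) computable
coefficients», p.373 tl.30–31). A hypothesis on `F`. [cite: MagnenRivasseauSeneor1993, §VI (VI.18)–(VI.19) pp.373–374] -/
def SmallBetaExpansion (F : ℝ → ℝ → ℝ → ℝ → ℝ) (ζ β₀ C : ℝ) : Prop :=
  ∀ β κ t : ℝ, 0 ≤ β → β ≤ β₀ → 0 ≤ κ → κ ≤ 1 → 0 ≤ t → t ≤ 1 → F β κ t ζ ≤ -(β / 4) + C * β ^ 2

/-- (H2) «κ, t, cosθ, sinφ … all vary in compact intervals» (p.374 tl.4): on a middle range `β ∈ [a, b]`, `κ, t ∈ [0,1]`, `F ≤ B`.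
A hypothesis on `F`. [cite: MagnenRivasseauSeneor1993, §VI p.374] -/
def MiddleRangeBound (F : ℝ → ℝ → ℝ → ℝ → ℝ) (ζ a b B : ℝ) : Prop :=
  ∀ β κ t : ℝ, a ≤ β → β ≤ b → 0 ≤ κ → κ ≤ 1 → 0 ≤ t → t ≤ 1 → F β κ t ζ ≤ B

/-- (H3) «the logarithms of explicit polynomials in β such as those of (VI.14) are bounded by a constant times β at large β (uniform in κ,
t, cosθ, sinφ, ζ and ζ⁻¹ by compactness)» (p.374 tl.6–8): `F ≤ C′β` for `β ≥ β₁`, `κ, t ∈ [0,1]`. A hypothesis on `F`.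
[cite: MagnenRivasseauSeneor1993, §VI p.374] -/
def LargeBetaLinear (F : ℝ → ℝ → ℝ → ℝ → ℝ) (ζ β₁ C' : ℝ) : Prop :=
  ∀ β κ t : ℝ, β₁ ≤ β → 0 ≤ κ → κ ≤ 1 → 0 ≤ t → t ≤ 1 → F β κ t ζ ≤ C' * β

/-- The small-β arithmetic of (VI.20b): `−β/4 + Cβ² ≤ −β/8` for `0 ≤ β ≤ 1/(8C + 1)`, `C ≥ 0` (indeed for `β ≤ 1/(8C)` when `C > 0`).
[cite: MagnenRivasseauSeneor1993, §VI (VI.20b) p.374] -/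
theorem smallBeta_arith {β C : ℝ} (hβ : 0 ≤ β) (hC : 0 ≤ C) (hβs : β ≤ 1 / (8 * C + 1)) :
    -(β / 4) + C * β ^ 2 ≤ -(β / 8) := by
  have h8 : 0 < 8 * C + 1 := by positivity
  have hCβ : C * β ≤ 1 / 8 := by
    have h1 : C * β ≤ C * (1 / (8 * C + 1)) := mul_le_mul_of_nonneg_left hβs hC
    have h2 : C * (1 / (8 * C + 1)) ≤ 1 / 8 := by
      rw [mul_one_div, div_le_div_iff₀ h8 (by norm_num : (0 : ℝ) < 8)]
      linarith
    linarith
  nlinarith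

/-- **Lemma VI.2 at a fixed ζ from the three inputs.** If (H1) holds with `β₀ > 0`, `C ≥ 0`; (H3) holds from some `β₁`; and (H2) holds on
the middle range `[K₁⁻¹, β₁]` where `K₁⁻¹ := min β₀ (1/(8C + 1))` — then the body of Lemma VI.2 holds at `ζ` with this `K₁` and
`K₂ := max C′ 0 + max B 0 · K₁ + 1`: «≤ K₂β if β ≥ (K₁)⁻¹; ≤ −(β/8) if β ≤ (K₁)⁻¹». This is the content of «it is easy to check»
(p.374 tl.8), with the inputs named. [cite: MagnenRivasseauSeneor1993, §VI Lemma VI.2 (VI.20a)–(VI.20b) p.374] -/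
theorem lemmaVI2_at_of_inputs {F : ℝ → ℝ → ℝ → ℝ → ℝ} {ζ β₀ C β₁ C' B : ℝ} (hβ₀ : 0 < β₀) (hC : 0 ≤ C)
    (h1 : SmallBetaExpansion F ζ β₀ C) (h3 : LargeBetaLinear F ζ β₁ C')
    (h2 : MiddleRangeBound F ζ (min β₀ (1 / (8 * C + 1))) β₁ B) :
    ∃ K₁ K₂ : ℝ, 0 < K₁ ∧ 0 < K₂ ∧
      ∀ β κ t : ℝ, 0 ≤ β → 0 ≤ κ → κ ≤ 1 → 0 ≤ t → t ≤ 1 →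
        (K₁⁻¹ ≤ β → F β κ t ζ ≤ K₂ * β) ∧ (β ≤ K₁⁻¹ → F β κ t ζ ≤ -(β / 8)) := by
  set a : ℝ := min β₀ (1 / (8 * C + 1)) with ha
  have ha0 : 0 < a := lt_min hβ₀ (by positivity)
  set K₁ : ℝ := a⁻¹ with hK₁
  have hK₁0 : 0 < K₁ := inv_pos.2 ha0
  have hK₁inv : K₁⁻¹ = a := by rw [hK₁, inv_inv]
  set K₂ : ℝ := max C' 0 + max B 0 * K₁ + 1 with hK₂
  have hK₂0 : 0 < K₂ := by
    have : 0 ≤ max C' 0 + max B 0 * K₁ := by positivity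
    linarith
  refine ⟨K₁, K₂, hK₁0, hK₂0, fun β κ t hβ hκ0 hκ1 ht0 ht1 => ⟨fun hge => ?_, fun hle => ?_⟩⟩
  · -- β ≥ a: either β ≥ β₁ (large) or a ≤ β ≤ β₁ (middle)
    rw [hK₁inv] at hge
    have hβpos : 0 < β := lt_of_lt_of_le ha0 hge
    have hK₁β : 1 ≤ K₁ * β := by
      rw [hK₁]
      calc (1 : ℝ) = a⁻¹ * a := by field_simp
        _ ≤ a⁻¹ * β := mul_le_mul_of_nonneg_left hge (inv_nonneg.2 ha0.le)
    rcases le_or_gt β₁ β with hlarge | hmid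
    · have hF := h3 β κ t hlarge hκ0 hκ1 ht0 ht1
      have : C' * β ≤ K₂ * β := by
        apply mul_le_mul_of_nonneg_right _ hβ
        have : C' ≤ max C' 0 := le_max_left _ _
        have : 0 ≤ max B 0 * K₁ := by positivity
        linarith
      linarith
    · have hF := h2 β κ t hge hmid.le hκ0 hκ1 ht0 ht1
      have hB : B ≤ max B 0 := le_max_left _ _
      have : max B 0 ≤ max B 0 * K₁ * β := by
        calc max B 0 = max B 0 * 1 := (mul_one _).symm
          _ ≤ max B 0 * (K₁ * β) := mul_le_mul_of_nonneg_left hK₁β (le_max_right _ _)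
          _ = max B 0 * K₁ * β := by ring
      have hK₂β : max B 0 * K₁ * β ≤ K₂ * β := by
        apply mul_le_mul_of_nonneg_right _ hβ
        have : 0 ≤ max C' 0 := le_max_right _ _
        linarith
      linarith
  · -- β ≤ a ≤ β₀ and ≤ 1/(8C+1)
    rw [hK₁inv] at hle
    have hβ₀' : β ≤ β₀ := hle.trans (min_le_left _ _)
    have hβC : β ≤ 1 / (8 * C + 1) := hle.trans (min_le_right _ _)
    have hF := h1 β κ t hβ hβ₀' hκ0 hκ1 ht0 ht1
    exact hF.trans (smallBeta_arith hβ hC hβC)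

/-- Hence: if for every `ζ ∈ [0,1]` the three inputs are available (with the middle range matched to the small-β threshold), the printed
Lemma VI.2 (`Stability.LemmaVI2Printed`) holds for `F`. [cite: MagnenRivasseauSeneor1993, §VI Lemma VI.2 p.374] -/
theorem lemmaVI2Printed_of_inputs {F : ℝ → ℝ → ℝ → ℝ → ℝ}
    (h : ∀ ζ : ℝ, 0 ≤ ζ → ζ ≤ 1 → ∃ β₀ C β₁ C' B : ℝ, 0 < β₀ ∧ 0 ≤ C ∧ SmallBetaExpansion F ζ β₀ C ∧
      LargeBetaLinear F ζ β₁ C' ∧ MiddleRangeBound F ζ (min β₀ (1 / (8 * C + 1))) β₁ B) :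
    LemmaVI2Printed F := by
  intro ζ hζ0 hζ1
  obtain ⟨β₀, C, β₁, C', B, hβ₀, hC, h1, h3, h2⟩ := h ζ hζ0 hζ1
  exact lemmaVI2_at_of_inputs hβ₀ hC h1 h3 h2

end Stability

end Literature.MathematicalPhysics.QuantumFieldTheory.MagnenRivasseauSeneor1993
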